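import Mathlib
import HarnessLib
import Summits.Ventures.LatticeQCDFlow.Exactness.SUNResidualJacobiIdentity
import Literature.Analysis.ODE.LiouvilleFormula
import Literature.MathematicalPhysics.QuantumFieldTheory.Luscher2010.FlowExistenceProofs

/-!
# Jacobi's formula along the inverse `SU(N)` residual isotopy: `d/ds det Top = −(div_a Z) det Top`, link by link

HONEST FRAMING: exact (Metropolis-corrected) sampling algorithms for lattice gauge theory;
figures of merit are autocorrelation/cost numbers at stated couplings and volumes; no
continuum-physics claim.

Venture `LatticeQCDFlow` (cell pub-lqcd), topic `Exactness`; FANOUT row 10 (`eng-equiv`: `equiv/residual.py`,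
`flows_jax/residual_flow.py` — residual / stout / stout-defect layers and their closed-form per-link log-det).
NEW WORK of the cell; no definition (local notations only); nothing cited as a fact.  Series "the residual
layer's exact Jacobian IS the closed form" (8 files: `SUNJacobianTraceAlgebra`, `SUNResidualTangentDerivative`,
`SUNResidualTangentTimeDerivative`, `SUNResidualGeneratorDivergence`, `SUNResidualJacobiTrace`,
`SUNResidualJacobiIdentity`, `SUNResidualJacobiFlow`, `SUNResidualLayerJacobianDet`), continuing gen-11's
`SUNResidualLayerVelocity` … `SUNResidualLayerJacobian` (existence of a continuous positive exact Jacobian).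

File 7 of the series (local notations as before).
* **`hasDerivAt_det_residualTangentOp_flow`** — for the generator `Z` of the inverse residual isotopy, ANY flow map
  `Φ` of `Z` on `SU(n)^E`, an active link `a` and `T_s := Top[σ(s), Φ_s V, a]`:
  `d/ds det T_s = det T_s · (−∑_b (∂_{single a (T^b (Φ_s V)_a)} Z_{s,a})^b)` — the tree's Jacobi formula
  `Literature.Analysis.ODE.hasDerivWithinAt_det_of_pointwise` with `B = Ṫ T⁻¹`, `tr(Ṫ T⁻¹) = tr(T⁻¹ Ṫ)` read as a
  compressed trace, the chain rule (`τ`-part: identity (II); `W`-part: only the link `a` contributes), and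
  `jacobi_trace_identity`.

Printed counterparts, NAMED ONLY: Lüscher, CMP 293 (2010) 899, §3 eqs. (3.4)–(3.9); Abbott et al.,
arXiv:2305.02402 §4.2; Morningstar–Peardon, PRD 69 (2004) 054501; Abel–Jacobi–Liouville (tree:
`Literature.Analysis.ODE.LiouvilleFormula`).
-/

noncomputable section

namespace Summit.Ventures.LatticeQCDFlow.Exactness

open Literature.MathematicalPhysics.QuantumFieldTheory
open Literature.MathematicalPhysics.QuantumFieldTheory.Luscher2010
open Literature.MathematicalPhysics.QuantumFieldTheory.WilsonFlow
open Summit.Ventures.LatticeQCDFlow.TrivializingMaps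
open MeasureTheory Filter Set
open scoped Matrix Matrix.Norms.Frobenius Topology ContDiff ENNReal

variable {d L n : ℕ} [NeZero L]

section Flow

variable (p : Edge d L → Prop) [DecidablePred p]
  (Q : {e : Edge d L // p e} → ({f : Edge d L // ¬p f} → Matrix.specialUnitaryGroup (Fin n) ℂ) →
    Matrix (Fin n) (Fin n) ℂ → Matrix (Fin n) (Fin n) ℂ)
  (κ : {e : Edge d L // p e} → ({f : Edge d L // ¬p f} → Matrix.specialUnitaryGroup (Fin n) ℂ) → ℝ)
  (Qamb : {e : Edge d L // p e} → AmbConfig d L n → Matrix (Fin n) (Fin n) ℂ)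

set_option quotPrecheck false in
/-- The residual isotopy at time `τ` (local notation, as in `SUNResidualIsotopy`). -/
local notation "famb[" τ "]" => (fun (W : AmbConfig d L n) (e : Edge d L) =>
  if h : p e then NormedSpace.exp ((τ : ℝ) • Qamb ⟨e, h⟩ W) * W e else W e)

set_option quotPrecheck false in
/-- The block of the tangential operator (local notation, as in `SUNResidualTangentOperator`). -/
local notation "Blk[" τ ", " W ", " a "]" =>
  ((fderiv ℝ (fun Y : Matrix (Fin n) (Fin n) ℂ => Y * ((famb[τ]) W a)ᴴ) 0).comp
    ((fderiv ℝ (fun W' : AmbConfig d L n => W' a) 0).comp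
      ((fderiv ℝ (famb[τ]) W).comp
        ((fderiv ℝ (fun Y : Matrix (Fin n) (Fin n) ℂ => (Pi.single a Y : AmbConfig d L n)) 0).comp
          (fderiv ℝ (fun Y : Matrix (Fin n) (Fin n) ℂ => Y * W a) 0)))))

set_option quotPrecheck false in
/-- The tangential operator (local notation, as in `SUNResidualTangentOperator`). -/
local notation "Top[" τ ", " W ", " a "]" =>
  ((fderiv ℝ (suProj (n := n)) 0).comp ((Blk[τ, W, a]).comp (fderiv ℝ (suProj (n := n)) 0)) +
    (ContinuousLinearMap.id ℝ (Matrix (Fin n) (Fin n) ℂ) - fderiv ℝ (suProj (n := n)) 0))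

set_option quotPrecheck false in
/-- The time reparametrisation `σ(s) = (1 − cos πs)/2` (local notation). -/
local notation "σ(" s ")" => ((1 - Real.cos (Real.pi * s)) / 2)

set_option quotPrecheck false in
/-- Its derivative `σ′(s) = (π/2) sin πs` (local notation). -/
local notation "σ'(" s ")" => (Real.pi / 2 * Real.sin (Real.pi * s))

omit [NeZero L] in
/-- `σ` has derivative `σ′`. -/
theorem hasDerivAt_sigma (s : ℝ) : HasDerivAt (fun u : ℝ => σ(u)) (σ'(s)) s := by
  have h1 : HasDerivAt (fun u : ℝ => Real.pi * u) Real.pi s := by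
    simpa using (hasDerivAt_id s).const_mul Real.pi
  have h2 := (h1.cos.const_sub 1).div_const 2
  exact h2.congr_deriv (by ring)

/-! ## Jacobi's formula along the inverse isotopy, one active link at a time -/

/-- **`d/ds det Top = −div_a · det Top` along the flow.**  Let `Z` be the generator of the inverse residual
isotopy (tangent, zero on frozen links, cancellation identity) and `Φ` ANY flow map of `Z` on `SU(n)^E`.
For an active link `a` and `T_s := Top[σ(s), Φ_s V, a]`:
`d/ds det T_s = det T_s · (−∑_b (∂_{single a (T^b (Φ_s V)_a)} Z_{s,a})^b)`
(Jacobi's formula for operator curves, `Literature.Analysis.ODE.LiouvilleFormula`, plus the trace identity). -/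
theorem hasDerivAt_det_residualTangentOp_flow (B : SuBasis n) (hQ2 : ∀ a, ContDiff ℝ 2 (Qamb a))
    (hQ : ∀ a y, ∀ U ∈ Matrix.specialUnitaryGroup (Fin n) ℂ, (Q a y U)ᴴ = -Q a y U ∧ (Q a y U).trace = 0)
    (hlip : ∀ a y, ∀ U ∈ Matrix.specialUnitaryGroup (Fin n) ℂ, ∀ V ∈ Matrix.specialUnitaryGroup (Fin n) ℂ,
      frobNorm (Q a y U - Q a y V) ≤ κ a y * frobNorm (U - V))
    (hκ0 : ∀ a y, 0 ≤ κ a y) (hκ : ∀ a y, κ a y < 1)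
    (hQambQ : ∀ a (U : GaugeConfig d L (Matrix.specialUnitaryGroup (Fin n) ℂ)),
      Qamb a (coeConfig U) = Q a (fun f => U f) (U a.1 : Matrix (Fin n) (Fin n) ℂ))
    {Z : ℝ → AmbConfig d L n → AmbConfig d L n}
    (hZ1 : ContDiff ℝ 1 (fun q : ℝ × AmbConfig d L n => Z q.1 q.2))
    (hZsu : ∀ (s : ℝ) (U : GaugeConfig d L (Matrix.specialUnitaryGroup (Fin n) ℂ)) (e : Edge d L),
      (Z s (coeConfig U) e)ᴴ = -Z s (coeConfig U) e ∧ (Z s (coeConfig U) e).trace = 0)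
    (hZ0 : ∀ (s : ℝ) (W : AmbConfig d L n) (e : Edge d L), ¬p e → Z s W e = 0)
    (hZid : ∀ (s : ℝ) (U : GaugeConfig d L (Matrix.specialUnitaryGroup (Fin n) ℂ)) (a : Edge d L) (ha : p a),
      fderiv ℝ (famb[σ(s)]) (coeConfig U) (Pi.single a (Z s (coeConfig U) a * (U a : Matrix (Fin n) (Fin n) ℂ))) a =
        -(σ'(s) • (Qamb ⟨a, ha⟩ (coeConfig U) *
          (NormedSpace.exp (σ(s) • Qamb ⟨a, ha⟩ (coeConfig U)) * (U a : Matrix (Fin n) (Fin n) ℂ)))))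
    {Φ : ℝ → GaugeConfig d L (Matrix.specialUnitaryGroup (Fin n) ℂ) →
      GaugeConfig d L (Matrix.specialUnitaryGroup (Fin n) ℂ)} (hΦ : IsFlowMap Z Φ)
    (V : GaugeConfig d L (Matrix.specialUnitaryGroup (Fin n) ℂ)) {a : Edge d L} (ha : p a) (s : ℝ) :
    HasDerivAt (fun u : ℝ => (Top[σ(u), coeConfig (Φ u V), a]).det)
      ((Top[σ(s), coeConfig (Φ s V), a]).det *
        -(∑ b, B.coord b (fderiv ℝ (fun W : AmbConfig d L n => Z s W a) (coeConfig (Φ s V))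
          (Pi.single a (B.T b * ((Φ s V) a : Matrix (Fin n) (Fin n) ℂ)))))) s := by
  letI i1 : NormedAddCommGroup (Matrix (Fin n) (Fin n) ℂ →L[ℝ] Matrix (Fin n) (Fin n) ℂ) :=
    ContinuousLinearMap.toNormedAddCommGroup
  letI i2 : NormedSpace ℝ (Matrix (Fin n) (Fin n) ℂ →L[ℝ] Matrix (Fin n) (Fin n) ℂ) :=
    ContinuousLinearMap.toNormedSpace
  haveI : FiniteDimensional ℝ (Matrix (Fin n) (Fin n) ℂ) := inferInstance
  -- the flow line and the reparametrised curve
  have hWd : ∀ u, HasDerivAt (fun u : ℝ => coeConfig (Φ u V)) (FlowExistence.vf₀ Z u (coeConfig (Φ u V))) u :=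
    fun u => FlowExistence.hasDerivAt_of_isFlowLine (hΦ.2 V) u
  have hcurve : HasDerivAt (fun u : ℝ => ((σ(u), coeConfig (Φ u V)) : ℝ × AmbConfig d L n))
      ((σ'(s), FlowExistence.vf₀ Z s (coeConfig (Φ s V)))) s := (hasDerivAt_sigma s).prodMk (hWd s)
  set U := Φ s V with hU
  set pt : ℝ × AmbConfig d L n := (σ(s), coeConfig U) with hpt
  set dir : ℝ × AmbConfig d L n := (σ'(s), FlowExistence.vf₀ Z s (coeConfig U)) with hdir
  -- the operator curve and its derivative `K`
  set K : Matrix (Fin n) (Fin n) ℂ →L[ℝ] Matrix (Fin n) (Fin n) ℂ :=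
    fderiv ℝ (fun q : ℝ × AmbConfig d L n => Top[q.1, q.2, a]) pt dir with hK
  have hOp : HasDerivAt (fun u : ℝ => Top[σ(u), coeConfig (Φ u V), a]) K s :=
    (hasFDerivAt_residualTangentOpMap p Qamb hQ2 a pt).comp_hasDerivAt s hcurve
  -- the operator at time `s` is a unit
  have hσabs : |σ(s)| ≤ 1 := by
    have h1 := Real.cos_le_one (Real.pi * s)
    have h2 := Real.neg_one_le_cos (Real.pi * s)
    rw [abs_le]
    constructor <;> nlinarith
  set T := Top[σ(s), coeConfig U, a] with hTdef
  have hT : IsUnit T := isUnit_residualTangentOp p Q κ Qamb hQ2 hQ hlip hκ0 hκ hQambQ hσabs U ha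
  set Ti := ContinuousLinearMap.inverse T with hTidef
  have hTi_T : ∀ x, Ti (T x) = x := fun x => residualTangentOp_inverse_apply_left p Qamb (σ(s)) (coeConfig U) a hT x
  have hTiP : ∀ y, Ti (suProj y) = suProj (Ti y) := fun y =>
    residualTangentOp_inverse_suProj_comm p Qamb (σ(s)) (coeConfig U) a hT y
  -- Jacobi's formula
  set Bop := K.comp Ti with hBop
  have hpt' : ∀ v, HasDerivWithinAt (fun u : ℝ => (Top[σ(u), coeConfig (Φ u V), a]) v) (Bop (T v)) Set.univ s := by
    intro v
    have h := (ContinuousLinearMap.apply ℝ (Matrix (Fin n) (Fin n) ℂ) v).hasFDerivAt.comp_hasDerivAt s hOp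
    have hval : (ContinuousLinearMap.apply ℝ (Matrix (Fin n) (Fin n) ℂ) v) K = Bop (T v) := by
      show K v = K (Ti (T v))
      rw [hTi_T]
    rw [hval] at h
    exact h.hasDerivWithinAt
  have hJac := (Literature.Analysis.ODE.hasDerivWithinAt_det_of_pointwise hpt').hasDerivAt
    (Filter.univ_mem)
  -- it remains to identify the trace of `Bop`
  refine hJac.congr_deriv ?_
  congr 1
  -- `tr (K Ti) = tr (Ti K)`
  have hcomm : LinearMap.trace ℝ _ (Bop : Matrix (Fin n) (Fin n) ℂ →ₗ[ℝ] Matrix (Fin n) (Fin n) ℂ) =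
      LinearMap.trace ℝ _ ((Ti.comp K : Matrix (Fin n) (Fin n) ℂ →L[ℝ] Matrix (Fin n) (Fin n) ℂ) :
        Matrix (Fin n) (Fin n) ℂ →ₗ[ℝ] Matrix (Fin n) (Fin n) ℂ) := by
    rw [hBop]
    exact (LinearMap.trace_comp_comm' (K : Matrix (Fin n) (Fin n) ℂ →ₗ[ℝ] Matrix (Fin n) (Fin n) ℂ)
      (Ti : Matrix (Fin n) (Fin n) ℂ →ₗ[ℝ] Matrix (Fin n) (Fin n) ℂ)).symm
  rw [hcomm]
  -- the structure of `K`: `K v = 𝒫 (β v)`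
  set β : Matrix (Fin n) (Fin n) ℂ → Matrix (Fin n) (Fin n) ℂ := fun v =>
    fderiv ℝ (fun q : ℝ × AmbConfig d L n => (Blk[q.1, q.2, a]) (suProj v)) pt dir with hβ
  have hKv : ∀ v, K v = suProj (β v) := by
    intro v
    have h1 : HasDerivAt (fun u : ℝ => (Top[σ(u), coeConfig (Φ u V), a]) v) (K v) s :=
      (ContinuousLinearMap.apply ℝ (Matrix (Fin n) (Fin n) ℂ) v).hasFDerivAt.comp_hasDerivAt s hOp
    have hblk : HasDerivAt (fun u : ℝ => (Blk[σ(u), coeConfig (Φ u V), a]) (suProj v)) (β v) s := by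
      have hd : DifferentiableAt ℝ (fun q : ℝ × AmbConfig d L n => (Blk[q.1, q.2, a]) (suProj v)) pt :=
        ((contDiff_residualTangentBlock_apply p Qamb hQ2 a (suProj v)).differentiable (by norm_num)).differentiableAt
      exact hd.hasFDerivAt.comp_hasDerivAt s hcurve
    have hP : HasFDerivAt (suProj (n := n)) (fderiv ℝ (suProj (n := n)) 0)
        ((Blk[σ(s), coeConfig (Φ s V), a]) (suProj v)) := by
      have hd : DifferentiableAt ℝ (suProj (n := n)) ((Blk[σ(s), coeConfig (Φ s V), a]) (suProj v)) :=
        ((contDiff_suProj (m := 1)).differentiable (by norm_num)).differentiableAt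
      have heq : fderiv ℝ (suProj (n := n)) ((Blk[σ(s), coeConfig (Φ s V), a]) (suProj v)) =
          fderiv ℝ (suProj (n := n)) 0 := by
        ext Y
        rw [fderiv_suProj_apply, fderiv_suProj_apply]
      rw [← heq]
      exact hd.hasFDerivAt
    have h2 := (hP.comp_hasDerivAt s hblk).add_const (v - suProj v)
    have hfun : (fun u : ℝ => (Top[σ(u), coeConfig (Φ u V), a]) v) =
        fun u => suProj ((Blk[σ(u), coeConfig (Φ u V), a]) (suProj v)) + (v - suProj v) := by
      funext u
      rw [residualTangentOp_apply, residualTangentBlock_apply]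
    rw [hfun] at h1
    have h3 := h1.unique h2
    exact h3.trans (fderiv_suProj_apply 0 _)
  -- `Ti K = 𝒫 (Ti K) 𝒫`
  have hsand : ((Ti.comp K : Matrix (Fin n) (Fin n) ℂ →L[ℝ] Matrix (Fin n) (Fin n) ℂ) :
        Matrix (Fin n) (Fin n) ℂ →ₗ[ℝ] Matrix (Fin n) (Fin n) ℂ) =
      (((fderiv ℝ (suProj (n := n)) 0).comp ((Ti.comp K).comp (fderiv ℝ (suProj (n := n)) 0)) :
        Matrix (Fin n) (Fin n) ℂ →L[ℝ] Matrix (Fin n) (Fin n) ℂ) : Matrix (Fin n) (Fin n) ℂ →ₗ[ℝ] Matrix (Fin n) (Fin n) ℂ) := by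
    apply LinearMap.ext
    intro v
    change Ti (K v) = fderiv ℝ (suProj (n := n)) 0 (Ti (K (fderiv ℝ (suProj (n := n)) 0 v)))
    rw [fderiv_suProj_apply, fderiv_suProj_apply, hKv, hKv, hTiP, hTiP, suProj_suProj]
    have hββ : β (suProj v) = β v := by
      simp only [hβ, suProj_suProj]
    rw [hββ]
  rw [hsand, trace_suProj_comp_comp_suProj B]
  -- evaluate `K T^b`
  have hTb : ∀ b, (B.T b)ᴴ = -B.T b ∧ (B.T b).trace = 0 := fun b => (mem_suAlgebra_iff _).1 (B.mem b)
  have hdir_split : dir = σ'(s) • ((1 : ℝ), (0 : AmbConfig d L n)) + ((0 : ℝ), FlowExistence.vf₀ Z s (coeConfig U)) := by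
    rw [hdir, Prod.smul_mk, smul_eq_mul, mul_one, smul_zero, Prod.mk_add_mk, add_zero, zero_add]
  -- the `τ`-part
  have hτpart : ∀ b, fderiv ℝ (fun q : ℝ × AmbConfig d L n => (Blk[q.1, q.2, a]) (B.T b)) pt ((1 : ℝ), (0 : AmbConfig d L n)) =
      fderiv ℝ (Qamb ⟨a, ha⟩) (coeConfig U) (Pi.single a (B.T b * (U a : Matrix (Fin n) (Fin n) ℂ)))
        + (Qamb ⟨a, ha⟩ (coeConfig U) * (Blk[σ(s), coeConfig U, a]) (B.T b)
          - (Blk[σ(s), coeConfig U, a]) (B.T b) * Qamb ⟨a, ha⟩ (coeConfig U)) := by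
    intro b
    have hd : DifferentiableAt ℝ (fun q : ℝ × AmbConfig d L n => (Blk[q.1, q.2, a]) (B.T b)) pt :=
      ((contDiff_residualTangentBlock_apply p Qamb hQ2 a (B.T b)).differentiable (by norm_num)).differentiableAt
    have h1 : HasDerivAt (fun τ : ℝ => (Blk[τ, coeConfig U, a]) (B.T b))
        (fderiv ℝ (fun q : ℝ × AmbConfig d L n => (Blk[q.1, q.2, a]) (B.T b)) pt ((1 : ℝ), (0 : AmbConfig d L n)))
        (σ(s)) :=
      HasFDerivAt.comp_hasDerivAt_of_eq (l := fun q : ℝ × AmbConfig d L n => (Blk[q.1, q.2, a]) (B.T b))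
        (f := fun τ : ℝ => ((τ, coeConfig U) : ℝ × AmbConfig d L n)) (σ(s)) hd.hasFDerivAt
        ((hasDerivAt_id (σ(s))).prodMk (hasDerivAt_const (σ(s)) (coeConfig U))) (by rw [hpt])
    exact h1.unique (hasDerivAt_residualTangentBlock_tau p Q Qamb hQ2 hQ hQambQ U ha (B.T b) (σ(s)))
  -- the `W`-part
  have hWpart : ∀ b, fderiv ℝ (fun q : ℝ × AmbConfig d L n => (Blk[q.1, q.2, a]) (B.T b)) pt
      ((0 : ℝ), FlowExistence.vf₀ Z s (coeConfig U)) =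
      fderiv ℝ (fun W' : AmbConfig d L n => (Blk[σ(s), W', a]) (B.T b)) (coeConfig U)
        (Pi.single a (Z s (coeConfig U) a * (U a : Matrix (Fin n) (Fin n) ℂ))) := by
    intro b
    have hd : DifferentiableAt ℝ (fun q : ℝ × AmbConfig d L n => (Blk[q.1, q.2, a]) (B.T b)) pt :=
      ((contDiff_residualTangentBlock_apply p Qamb hQ2 a (B.T b)).differentiable (by norm_num)).differentiableAt
    have h1 : HasFDerivAt (fun W' : AmbConfig d L n => (Blk[σ(s), W', a]) (B.T b))
        ((fderiv ℝ (fun q : ℝ × AmbConfig d L n => (Blk[q.1, q.2, a]) (B.T b)) pt).comp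
          (ContinuousLinearMap.inr ℝ ℝ (AmbConfig d L n))) (coeConfig U) :=
      hd.hasFDerivAt.comp (coeConfig U) (hasFDerivAt_prodMk_right (𝕜 := ℝ) (E := ℝ) (F := AmbConfig d L n)
        (σ(s)) (coeConfig U))
    have h2 : fderiv ℝ (fun q : ℝ × AmbConfig d L n => (Blk[q.1, q.2, a]) (B.T b)) pt
        ((0 : ℝ), FlowExistence.vf₀ Z s (coeConfig U)) =
        fderiv ℝ (fun W' : AmbConfig d L n => (Blk[σ(s), W', a]) (B.T b)) (coeConfig U)
          (FlowExistence.vf₀ Z s (coeConfig U)) := by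
      rw [h1.fderiv]
      rfl
    rw [h2]
    -- the velocity as a sum of single-link directions
    have hvf : FlowExistence.vf₀ Z s (coeConfig U) =
        ∑ e : Edge d L, Pi.single e (Z s (coeConfig U) e * coeConfig U e) := by
      rw [Finset.univ_sum_single]
      rfl
    rw [hvf, map_sum]
    rw [Finset.sum_eq_single a]
    · rw [coeConfig_apply]
    · intro e _ hea
      by_cases he : p e
      · obtain ⟨hz1, hz2⟩ := hZsu s U e
        rw [coeConfig_apply,
          fderiv_residualTangentBlock_eq_fderiv_residualTangentOp p Q κ Qamb hQ2 hQ hlip hQambQ (σ(s)) U ha e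
            hz1 hz2 (hTb b).1 (hTb b).2]
        exact fderiv_residualTangentOp_apply_single_of_ne p Q Qamb hQ2 hQambQ (σ(s)) U ha he hea hz1 hz2 (B.T b)
      · rw [hZ0 s (coeConfig U) e he, zero_mul, Pi.single_zero, map_zero]
    · intro h
      exact absurd (Finset.mem_univ a) h
  have hKT : ∀ b, K (B.T b) = suProj (σ'(s) • (fderiv ℝ (Qamb ⟨a, ha⟩) (coeConfig U)
      (Pi.single a (B.T b * (U a : Matrix (Fin n) (Fin n) ℂ)))
        + (Qamb ⟨a, ha⟩ (coeConfig U) * (Blk[σ(s), coeConfig U, a]) (B.T b)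
          - (Blk[σ(s), coeConfig U, a]) (B.T b) * Qamb ⟨a, ha⟩ (coeConfig U)))
      + fderiv ℝ (fun W' : AmbConfig d L n => (Blk[σ(s), W', a]) (B.T b)) (coeConfig U)
          (Pi.single a (Z s (coeConfig U) a * (U a : Matrix (Fin n) (Fin n) ℂ)))) := by
    intro b
    rw [hKv]
    have hβb : β (B.T b) = fderiv ℝ (fun q : ℝ × AmbConfig d L n => (Blk[q.1, q.2, a]) (B.T b)) pt dir := by
      simp only [hβ, suProj_eq_self (hTb b).1 (hTb b).2]
    rw [hβb, hdir_split, map_add, map_smul, hτpart, hWpart]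
  simp_rw [ContinuousLinearMap.comp_apply, hKT]
  rw [← coeConfig_apply U a]
  exact jacobi_trace_identity p Q κ Qamb B hQ2 hQ hlip hκ0 hκ hQambQ hZ1 hZsu hZid s U ha

end Flow

end Summit.Ventures.LatticeQCDFlow.Exactness

end
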